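import Mathlib
import Literature.Analysis.ValidatedNumerics.ConeSeriesLaplacian
import Literature.Analysis.ValidatedNumerics.ConeMonomialFrechetDerivatives
import Literature.Analysis.Complex.LaplacianConformalPullback
import HarnessLib

/-!
# Cone series with `ϱ > 1` are `C²` on the open disk; the certificate's zero solves the PDE with Mathlib's `Δ`

Topic `Literature/Analysis/ValidatedNumerics`.  The last analytic link between a certnum F2 (B″)/(B-SL)
certificate and a classical PDE statement: for `ϱ > 1` and `u` in the cone Wiener algebra
`W = ℓ¹_ϱ(ζ^aζ̄^b)`, the represented function `eval u` (`ConeAlgebraEvaluation.lean`) is twice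
continuously FRÉCHET-differentiable (over `ℝ`) on the open unit disk:

* `hasFDerivAt_monomial`, `hasFDerivAt_monomialFD` — the `ℝ`-derivatives of `z ↦ z^p z̄^q`
  (`D(z) h = p z^{p−1}z̄^q h + q z^p z̄^{q−1} h̄`, written `lin (φ₁, φ₂)` with the fixed `ℝ`-linear map
  `lin (α, β) = α • 1 + β • conj`) and of `D` itself, with the disk bounds `‖D‖ ≤ 2(p+q)`,
  `‖D²‖ ≤ 4(p+q)²` (`norm_monomialFD_le`, `norm_monomialFD2_le`);
* `hasFDerivAt_eval`, `hasFDerivAt_evalFD` — termwise first and second Fréchet derivatives of `eval u` on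
  the open disk (`hasFDerivAt_tsum_of_isPreconnected`; summable bounds `2(a+b)|u_m|`, `4(a+b)²|u_m|`
  against `ϱ^{a+b}`, `ϱ > 1`), `continuousOn_evalFD2`, hence
  **`contDiffOn_eval : ContDiffOn ℝ 2 (eval u) (ball 0 1)`** and `contDiffAt_eval`;
* consequently Mathlib's Laplacian agrees with the directional one used so far
  (`laplacian_eval_eq_lapRI`, via `ConformalLaplacian.lapRI_eq_laplacian`, p550475), and the interior
  equation of the certificate's zero holds with Mathlib's `Δ`:
  **`laplacian_eval_of_semilinMap_eq_zero`: `Δ(eval x)(z) = v(z)·x(z) + Σ_{k≤m} c_k(z)·x(z)^k`** on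
  `|z| < 1` — the form the conformal pull-back `ConformalLaplacian.laplacian_comp_eq_of_analyticAt`
  (p550475) and the Liouville identity (p532316) consume.

## Sources

[ArioliKoch2019] §3 Lemma 3.1 ("If `ρ > 1` then the functions in `A_ρ` extend analytically to some complex
open neighborhood of `Ω`" — here only the `C²` consequence on the open disk is typed), §2 p. 6, sentence after (2.7)
(`∂_z`, `∂_z̄` as partial derivatives in the independent variables `z`, `z̄`; monomial rule = elementary
consequence — folklore), §2 proof of Lemma 2.1, p. 7 («4∂_z∂_z̄ = ∂_x² + ∂_y² = Δ»), eq. (1.4) (p. 4) and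
§4 Lemma 4.1 (pp. 9–10).

## What is NOT covered

Analyticity / `C^∞`; regularity up to the boundary; the composed Grad–Shafranov statement on `Ω_W`
(it additionally needs the client's chart `Φ` with an analytic inverse and the identification of the
coefficient series `v, c_k` with the chart's functions — hypotheses of the client); float model.

## Provenance

AI-produced formalisation (cell certnum, seat certnum-ode-2, 2026-08-27).
-/

set_option autoImplicit false

open scoped BigOperators Topology
open Complex Filter Set Metric InnerProductSpace
open scoped Laplacian

noncomputable section

namespace Literature.Analysis.ValidatedNumerics

namespace ConeEval

open WeightedSeq WienerAlgebra ConeMonomial ConeSemilinear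

/-- `‖c • T‖ ≤ |c|·‖T‖` for a real scalar on the space of second derivatives (proved by hand: the
generic `norm_smul` instance path is not found by instance search on this nested operator space). [folklore] -/
private theorem norm_smul_fd2_le (c : ℝ) (T : ℂ →L[ℝ] (ℂ →L[ℝ] ℂ)) : ‖c • T‖ ≤ |c| * ‖T‖ := by
  refine ContinuousLinearMap.opNorm_le_bound _ (by positivity) fun h => ?_
  rw [_root_.smul_apply, norm_smul, Real.norm_eq_abs, mul_assoc]
  exact mul_le_mul_of_nonneg_left (T.le_opNorm h) (abs_nonneg c)

/-! ### §2. The two Fréchet derivatives of `eval u` on the open disk -/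

variable {ϱ : ℝ}

/-- The termwise first derivative `Σ_m u_m • D M_m(z)` (real scalars). [cite: ArioliKoch2019, §3 Lemma 3.1] -/
def evalFD (hϱ : 1 ≤ ϱ) (u : Wiener (coneSubmultWeight hϱ)) (z : ℂ) : ℂ →L[ℝ] ℂ :=
  ∑' m, (cf u m) • monomialFD (m 0) (m 1) z

/-- The termwise second derivative `Σ_m u_m • D² M_m(z)`. [cite: ArioliKoch2019, §3 Lemma 3.1] -/
def evalFD2 (hϱ : 1 ≤ ϱ) (u : Wiener (coneSubmultWeight hϱ)) (z : ℂ) : ℂ →L[ℝ] (ℂ →L[ℝ] ℂ) :=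
  ∑' m, (cf u m) • monomialFD2 (m 0) (m 1) z

/-- `eval u` with real scalars: `eval u w = Σ_m u_m • M_m(w)`. [cite: ArioliKoch2019, §3 eq. (3.1)] -/
theorem eval_eq_tsum_smul (hϱ : 1 ≤ ϱ) (u : Wiener (coneSubmultWeight hϱ)) :
    eval hϱ u = fun w => ∑' m, (cf u m) • monomial (m 0) (m 1) w := by
  funext w
  unfold eval
  exact tsum_congr fun m => by rw [Complex.real_smul]; rfl

/-- **`D(eval u)(z) = evalFD u z`** on the open unit disk (`ϱ > 1`; termwise, bound `2(a+b)|u_m|`).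
[cite: ArioliKoch2019, §3 Lemma 3.1 (ρ > 1 regularity)] -/
theorem hasFDerivAt_eval (hϱ1 : 1 < ϱ) (u : Wiener (coneSubmultWeight hϱ1.le)) {z : ℂ} (hz : ‖z‖ < 1) :
    HasFDerivAt (eval hϱ1.le u) (evalFD hϱ1.le u z) z := by
  have hϱ : 1 ≤ ϱ := hϱ1.le
  have hzB : z ∈ ball (0 : ℂ) 1 := by rwa [mem_ball, dist_zero_right]
  have h0B : (0 : ℂ) ∈ ball (0 : ℂ) 1 := by simp
  set C : ℝ := 1 / (ϱ - 1) + 2 with hC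
  have hdom : Summable fun m => 2 * C * (|cf u m| * (coneSubmultWeight hϱ).toFun m) :=
    (mem_cf u).mul_left (2 * C)
  rw [eval_eq_tsum_smul]
  unfold evalFD
  refine hasFDerivAt_tsum_of_isPreconnected hdom isOpen_ball (convex_ball (0 : ℂ) 1).isPreconnected
    (fun m w _ => (hasFDerivAt_monomial (m 0) (m 1) w).const_smul (cf u m)) (fun m w hw => ?_) h0B
    ?_ hzB
  · rw [mem_ball, dist_zero_right] at hw
    rw [norm_smul, Real.norm_eq_abs]
    have hb := norm_monomialFD_le (m 0) (m 1) hw.le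
    have hg := (deg_le_weight hϱ1 m).1
    calc |cf u m| * ‖monomialFD (m 0) (m 1) w‖ ≤ |cf u m| * (2 * (C * (coneSubmultWeight hϱ).toFun m)) :=
          mul_le_mul_of_nonneg_left (hb.trans (by linarith)) (abs_nonneg _)
      _ = 2 * C * (|cf u m| * (coneSubmultWeight hϱ).toFun m) := by ring
  · exact (summable_term hϱ u (ζ := 0) (by simp)).congr fun m => by
      rw [Pi.smul_apply, Complex.real_smul]; rfl

/-- **`D(evalFD u)(z) = evalFD2 u z`** on the open unit disk (`ϱ > 1`; bound `4(a+b)²|u_m|`).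
[cite: ArioliKoch2019, §3 Lemma 3.1 (ρ > 1 regularity)] -/
theorem hasFDerivAt_evalFD (hϱ1 : 1 < ϱ) (u : Wiener (coneSubmultWeight hϱ1.le)) {z : ℂ} (hz : ‖z‖ < 1) :
    HasFDerivAt (evalFD hϱ1.le u) (evalFD2 hϱ1.le u z) z := by
  have hϱ : 1 ≤ ϱ := hϱ1.le
  have hzB : z ∈ ball (0 : ℂ) 1 := by rwa [mem_ball, dist_zero_right]
  have h0B : (0 : ℂ) ∈ ball (0 : ℂ) 1 := by simp
  set C₂ : ℝ := 2 / (ϱ - 1) ^ 2 + 1 / (ϱ - 1) with hC₂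
  set C₁ : ℝ := 1 / (ϱ - 1) + 2 with hC₁
  have hdom : Summable fun m => 4 * C₂ * (|cf u m| * (coneSubmultWeight hϱ).toFun m) :=
    (mem_cf u).mul_left (4 * C₂)
  unfold evalFD evalFD2
  refine hasFDerivAt_tsum_of_isPreconnected hdom isOpen_ball (convex_ball (0 : ℂ) 1).isPreconnected
    (fun m w _ => (hasFDerivAt_monomialFD (m 0) (m 1) w).const_smul (cf u m)) (fun m w hw => ?_) h0B
    ?_ hzB
  · rw [mem_ball, dist_zero_right] at hw
    refine (norm_smul_fd2_le _ _).trans ?_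
    have hb := norm_monomialFD2_le (m 0) (m 1) hw.le
    have hg := (deg_le_weight hϱ1 m).2
    calc |cf u m| * ‖monomialFD2 (m 0) (m 1) w‖ ≤ |cf u m| * (4 * (C₂ * (coneSubmultWeight hϱ).toFun m)) :=
          mul_le_mul_of_nonneg_left (hb.trans (by linarith)) (abs_nonneg _)
      _ = 4 * C₂ * (|cf u m| * (coneSubmultWeight hϱ).toFun m) := by ring
  · have hdom1 : Summable fun m => 2 * C₁ * (|cf u m| * (coneSubmultWeight hϱ).toFun m) :=
      (mem_cf u).mul_left (2 * C₁)
    refine Summable.of_norm_bounded hdom1 fun m => ?_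
    rw [Pi.smul_apply, norm_smul, Real.norm_eq_abs]
    have hb := norm_monomialFD_le (m 0) (m 1) (z := 0) (by simp)
    have hg := (deg_le_weight hϱ1 m).1
    calc |cf u m| * ‖monomialFD (m 0) (m 1) 0‖ ≤ |cf u m| * (2 * (C₁ * (coneSubmultWeight hϱ).toFun m)) :=
          mul_le_mul_of_nonneg_left (hb.trans (by linarith)) (abs_nonneg _)
      _ = 2 * C₁ * (|cf u m| * (coneSubmultWeight hϱ).toFun m) := by ring

set_option synthInstance.maxHeartbeats 200000 in
/-- The second-derivative series is continuous on the open disk (uniform convergence).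
[cite: ArioliKoch2019, §3 Lemma 3.1] -/
theorem continuousOn_evalFD2 (hϱ1 : 1 < ϱ) (u : Wiener (coneSubmultWeight hϱ1.le)) :
    ContinuousOn (evalFD2 hϱ1.le u) (ball 0 1) := by
  have hϱ : 1 ≤ ϱ := hϱ1.le
  set C₂ : ℝ := 2 / (ϱ - 1) ^ 2 + 1 / (ϱ - 1) with hC₂
  have hdom : Summable fun m => 4 * C₂ * (|cf u m| * (coneSubmultWeight hϱ).toFun m) :=
    (mem_cf u).mul_left (4 * C₂)
  unfold evalFD2
  refine continuousOn_tsum (f := fun m w => (cf u m) • monomialFD2 (m 0) (m 1) w)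
    (fun m => ((continuous_monomialFD2 (m 0) (m 1)).const_smul (cf u m)).continuousOn)
    hdom fun m w hw => ?_
  rw [mem_ball, dist_zero_right] at hw
  refine (norm_smul_fd2_le _ _).trans ?_
  have hb := norm_monomialFD2_le (m 0) (m 1) hw.le
  have hg := (deg_le_weight hϱ1 m).2
  calc |cf u m| * ‖monomialFD2 (m 0) (m 1) w‖ ≤ |cf u m| * (4 * (C₂ * (coneSubmultWeight hϱ).toFun m)) :=
        mul_le_mul_of_nonneg_left (hb.trans (by linarith)) (abs_nonneg _)
    _ = 4 * C₂ * (|cf u m| * (coneSubmultWeight hϱ).toFun m) := by ring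

/-- **`eval u` is `C²` (over `ℝ`, Fréchet) on the open unit disk** when `ϱ > 1`.
[cite: ArioliKoch2019, §3 Lemma 3.1 ("if ρ > 1 then the functions in A_ρ extend analytically …")] -/
theorem contDiffOn_eval (hϱ1 : 1 < ϱ) (u : Wiener (coneSubmultWeight hϱ1.le)) :
    ContDiffOn ℝ 2 (eval hϱ1.le u) (ball 0 1) := by
  have hB : IsOpen (ball (0 : ℂ) 1) := isOpen_ball
  have hmem : ∀ {w : ℂ}, w ∈ ball (0 : ℂ) 1 → ‖w‖ < 1 := fun hw => by rwa [mem_ball, dist_zero_right] at hw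
  -- first derivative
  have hD1 : ∀ w ∈ ball (0 : ℂ) 1, HasFDerivAt (eval hϱ1.le u) (evalFD hϱ1.le u w) w :=
    fun w hw => hasFDerivAt_eval hϱ1 u (hmem hw)
  have hD2 : ∀ w ∈ ball (0 : ℂ) 1, HasFDerivAt (evalFD hϱ1.le u) (evalFD2 hϱ1.le u w) w :=
    fun w hw => hasFDerivAt_evalFD hϱ1 u (hmem hw)
  have hfd1 : ∀ w ∈ ball (0 : ℂ) 1, fderiv ℝ (eval hϱ1.le u) w = evalFD hϱ1.le u w :=
    fun w hw => (hD1 w hw).fderiv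
  have hfd2 : ∀ w ∈ ball (0 : ℂ) 1, fderiv ℝ (evalFD hϱ1.le u) w = evalFD2 hϱ1.le u w :=
    fun w hw => (hD2 w hw).fderiv
  -- C¹ of the derivative
  have hC1 : ContDiffOn ℝ 1 (evalFD hϱ1.le u) (ball 0 1) := by
    rw [show (1 : WithTop ℕ∞) = 0 + 1 by norm_num, contDiffOn_succ_iff_fderiv_of_isOpen hB]
    refine ⟨fun w hw => (hD2 w hw).differentiableAt.differentiableWithinAt, fun h => ?_, ?_⟩
    · exact absurd h (by simp)
    · rw [contDiffOn_zero]
      exact (continuousOn_evalFD2 hϱ1 u).congr hfd2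
  rw [show (2 : WithTop ℕ∞) = 1 + 1 by norm_num, contDiffOn_succ_iff_fderiv_of_isOpen hB]
  refine ⟨fun w hw => (hD1 w hw).differentiableAt.differentiableWithinAt, fun h => ?_, ?_⟩
  · exact absurd h (by simp)
  · exact hC1.congr hfd1

/-- `eval u` is `C²` at every point of the open disk. [cite: ArioliKoch2019, §3 Lemma 3.1] -/
theorem contDiffAt_eval (hϱ1 : 1 < ϱ) (u : Wiener (coneSubmultWeight hϱ1.le)) {z : ℂ} (hz : ‖z‖ < 1) :
    ContDiffAt ℝ 2 (eval hϱ1.le u) z :=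
  (contDiffOn_eval hϱ1 u).contDiffAt (isOpen_ball.mem_nhds (by rwa [mem_ball, dist_zero_right]))

/-! ### §3. Mathlib's Laplacian of the represented function -/

/-- On the open disk Mathlib's Laplacian of `eval u` equals the directional form `ConeMonomial.lapRI`
(`ConformalLaplacian.lapRI_eq_laplacian`, which needs exactly the `C²` regularity above).
[cite: ArioliKoch2019, §2 proof of Lemma 2.1, p. 7 («4∂_z∂_z̄ = ∂_x² + ∂_y² = Δ»)] -/
theorem laplacian_eval_eq_lapRI (hϱ1 : 1 < ϱ) (u : Wiener (coneSubmultWeight hϱ1.le)) {z : ℂ}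
    (hz : ‖z‖ < 1) : Δ (eval hϱ1.le u) z = lapRI (eval hϱ1.le u) z :=
  (Literature.Analysis.Complex.ConformalLaplacian.lapRI_eq_laplacian (contDiffAt_eval hϱ1 u hz)).symm

/-- **The interior equation of the certificate's zero with Mathlib's Laplacian.**  For `ϱ > 1`, a zero
`x ∈ W` of `x − Δ_D⁻¹(v x + Σ_{k≤m} c_k x^k) − g` with harmonic (pure-power) datum `g` represents a
`C²` function on the open unit disk with `Δ(eval x)(z) = v(z)·x(z) + Σ_{k≤m} c_k(z)·x(z)^k`
(`ConeEval.lapRI_eval_of_semilinMap_eq_zero` + `laplacian_eval_eq_lapRI`); with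
`ConeEval.eval_eq_of_semilinMap_eq_zero` (`x = g` on the circle) this is the classical Dirichlet problem
of the `ζ`-chart, ready for the conformal pull-back (p550475) and the Liouville step (p532316).
[cite: ArioliKoch2019, eq. (1.4) (p. 4) and §4 Lemma 4.1 (pp. 9–10)] -/
theorem laplacian_eval_of_semilinMap_eq_zero (hϱ1 : 1 < ϱ) {v g x : Wiener (coneSubmultWeight hϱ1.le)}
    {c : ℕ → Wiener (coneSubmultWeight hϱ1.le)} {m : ℕ}
    (hx : Literature.Analysis.Calculus.PolynomialNonlinearity.semilinMap (dirInv hϱ1.le) v c m g x = 0)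
    (hg : ∀ n : Fin 2 →₀ ℕ, cf g n ≠ 0 → n 0 = 0 ∨ n 1 = 0) {z : ℂ} (hz : ‖z‖ < 1) :
    Δ (eval hϱ1.le x) z
      = eval hϱ1.le v z * eval hϱ1.le x z
        + ∑ k ∈ Finset.range (m + 1), eval hϱ1.le (c k) z * (eval hϱ1.le x z) ^ k := by
  rw [laplacian_eval_eq_lapRI hϱ1 x hz]
  exact lapRI_eval_of_semilinMap_eq_zero hϱ1 hx hg hz

/-! ### §4. Pull-back to the physical chart -/

/-- **The certificate's zero in the physical chart.**  Let `Φ` be the conformal pre-map of the certificate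
(disk → `Ω_W`) and `Ψ` a local analytic inverse at `w ∈ Ω_W` (`Φ (Ψ w') = w'` near `w`, `Ψ w` in the open
disk).  If the coefficient series are the chart's coefficient functions multiplied by the conformal factor
AT THE POINT — `v(Ψ w) = |Φ′(Ψ w)|² V₀`, `c_k(Ψ w) = |Φ′(Ψ w)|² C_k` (the identification the producer's ball
objects encode) — then the pulled-back function `u = (eval x) ∘ Ψ` of a zero `x` of the (B-SL) map with
harmonic datum satisfies, with Mathlib's Laplacian,
`Δu(w) = V₀ · u(w) + Σ_{k≤m} C_k · u(w)^k`
(conformal pull-back `ConformalLaplacian.laplacian_comp_eq_of_analyticAt`, p550475, and `|Ψ′(w)|·|Φ′(Ψ w)| = 1`).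
With `V₀ = ¾X⁻²` and the Liouville identity `GradShafranovSqrtOperator.gsOperator_sqrt_mul_eq_iff` (p532316)
this is the Grad–Shafranov equation for `U = √X·u` — that last rewriting needs real-valuedness of `u`
(symmetric coefficient families), not typed here.
[cite: ArioliKoch2019, eq. (1.4) (p. 4) and §4 Lemma 4.1 (pp. 9–10); AsmarGrafakos2018 Thm. 6.1.10 (conformal invariance of Δ)] -/
theorem laplacian_eval_comp_chart (hϱ1 : 1 < ϱ) {v g x : Wiener (coneSubmultWeight hϱ1.le)}
    {c : ℕ → Wiener (coneSubmultWeight hϱ1.le)} {m : ℕ}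
    (hx : Literature.Analysis.Calculus.PolynomialNonlinearity.semilinMap (dirInv hϱ1.le) v c m g x = 0)
    (hg : ∀ n : Fin 2 →₀ ℕ, cf g n ≠ 0 → n 0 = 0 ∨ n 1 = 0)
    {Φ Ψ : ℂ → ℂ} {w : ℂ} (hΨ : AnalyticAt ℂ Ψ w) (hΨw : ‖Ψ w‖ < 1) (hΦ : DifferentiableAt ℂ Φ (Ψ w))
    (hinv : ∀ᶠ w' in 𝓝 w, Φ (Ψ w') = w')
    {V₀ : ℂ} {C : ℕ → ℂ} (hv : eval hϱ1.le v (Ψ w) = (‖deriv Φ (Ψ w)‖ ^ 2 : ℝ) * V₀)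
    (hc : ∀ k, eval hϱ1.le (c k) (Ψ w) = (‖deriv Φ (Ψ w)‖ ^ 2 : ℝ) * C k) :
    Δ (eval hϱ1.le x ∘ Ψ) w
      = V₀ * eval hϱ1.le x (Ψ w) + ∑ k ∈ Finset.range (m + 1), C k * (eval hϱ1.le x (Ψ w)) ^ k := by
  -- conformal pull-back
  have h1 := Literature.Analysis.Complex.ConformalLaplacian.laplacian_comp_eq_of_analyticAt
    (u := eval hϱ1.le x) (contDiffAt_eval hϱ1 x hΨw) hΨ
  rw [h1, laplacian_eval_of_semilinMap_eq_zero hϱ1 hx hg hΨw, hv]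
  simp only [hc]
  -- `Ψ′(w) · Φ′(Ψ w) = 1`
  have hd : deriv Φ (Ψ w) * deriv Ψ w = 1 := by
    have hcomp : HasDerivAt (fun w' => Φ (Ψ w')) (deriv Φ (Ψ w) * deriv Ψ w) w :=
      hΦ.hasDerivAt.comp w hΨ.differentiableAt.hasDerivAt
    have hid : HasDerivAt (fun w' => Φ (Ψ w')) 1 w :=
      (hasDerivAt_id w).congr_of_eventuallyEq (hinv.mono fun w' hw' => by simp [hw'])
    exact hcomp.unique hid
  have hn : ‖deriv Ψ w‖ ^ 2 * ‖deriv Φ (Ψ w)‖ ^ 2 = 1 := by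
    rw [← mul_pow, ← norm_mul, mul_comm, hd, norm_one, one_pow]
  rw [Complex.real_smul]
  -- distribute and cancel the conformal factors
  have hnC : ((‖deriv Ψ w‖ ^ 2 : ℝ) : ℂ) * ((‖deriv Φ (Ψ w)‖ ^ 2 : ℝ) : ℂ) = 1 := by
    rw [← Complex.ofReal_mul, hn, Complex.ofReal_one]
  rw [mul_add, Finset.mul_sum]
  congr 1
  · calc ((‖deriv Ψ w‖ ^ 2 : ℝ) : ℂ) * (((‖deriv Φ (Ψ w)‖ ^ 2 : ℝ) : ℂ) * V₀ * eval hϱ1.le x (Ψ w))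
        = (((‖deriv Ψ w‖ ^ 2 : ℝ) : ℂ) * ((‖deriv Φ (Ψ w)‖ ^ 2 : ℝ) : ℂ)) * (V₀ * eval hϱ1.le x (Ψ w)) := by
          ring
      _ = V₀ * eval hϱ1.le x (Ψ w) := by rw [hnC, one_mul]
  · refine Finset.sum_congr rfl fun k _ => ?_
    calc ((‖deriv Ψ w‖ ^ 2 : ℝ) : ℂ) * (((‖deriv Φ (Ψ w)‖ ^ 2 : ℝ) : ℂ) * C k * eval hϱ1.le x (Ψ w) ^ k)
        = (((‖deriv Ψ w‖ ^ 2 : ℝ) : ℂ) * ((‖deriv Φ (Ψ w)‖ ^ 2 : ℝ) : ℂ)) * (C k * eval hϱ1.le x (Ψ w) ^ k) := by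
          ring
      _ = C k * eval hϱ1.le x (Ψ w) ^ k := by rw [hnC, one_mul]

end ConeEval

end Literature.Analysis.ValidatedNumerics
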